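import Summits.ResolutionOfSingularities.ResolutionOfSingularities.Theorems.EquisingularLiftEquisingularLiftNatDepthTower
import HarnessLib

/-!
# [OURS] WHAT THE ISOLATED RESIDUAL MUST CONTAIN: under «finite non-regular locus» and `¬ IsoHypPoint`, some singular point has NO finite blow-up depth
# (cruxes `Theses.EquisingularLift.EquisingularLiftNat` / `…NatThree`, stmt-ResolutionOfSingularities-20038 / -20148)

[OURS · leafhand-res-equisingularlift-10 g1, 2026-08-31; cell `pub/decomp-res`] AI-produced, weaker than expert review; NOT a statement of any manuscript;
nothing here proves resolution of singularities in positive characteristic.  DEF-FREE helper; no `sorry`; standard axioms; ZERO named hypotheses.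

The registered isolated residual stub `stub_elnat_three_isolated_nonNDLeaves9` carries, among its hypotheses, #2 `Set.Finite {x | ¬ IsRegularLocalRing 𝒪_x}` and
#7 `¬ IsoHypPoint k n H ι`.  The contrapositives of ✓ `isoHypPoint_of_finiteDepthPoints` (p831199) and ✓ `isoHypPoint_of_towerPoints` (p831323) say what such
an `H` must look like: provided its finitely many non-regular points have closed images in `ℙⁿ`, ONE OF THEM HAS NO LEVEL AT ALL —

* ★★ `exists_singularPoint_without_level` — for every depth-graded point-property `D` with UNFOLDING and LOCALITY: some non-regular `x` with `∀ d, ¬ D d H x`;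
* ★★★ `exists_singularPoint_of_infinite_depth` — **for every blow-up tower `D` (`hD0`, `hDsucc`): some non-regular point `x` of `H` has infinite intrinsic
  blow-up depth, `∀ d, ¬ D d H x`** — i.e. the residual isolated `H ⊆ ℙ³_k̄` is never resolved by finitely many rounds of closed-point blow-ups in the
  intrinsic sense (every round leaves a singular point over the previous one); absolutely-isolated configurations (`Aₙ, Dₙ, Eₙ`-type towers, cone vertices
  over smooth curves, …) are thereby OUTSIDE the residual once their tower levels are certified.

Honest label: closes no registered stub; it sharpens the description of the residual class (a repair-census datum for the planner).

References: [StacksProject, Tags 080E, 02OS]; [Hartshorne1977, II Ex. 7.12, V 3.9] — through the cited tree files.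
-/

set_option linter.dupNamespace false -- mandated namespace `Summit.<Summit>.<Problem>` of this single-conjunct summit

noncomputable section

open CategoryTheory CategoryTheory.Limits AlgebraicGeometry TopologicalSpace
open Literature.AlgebraicGeometry.Resolution Literature.AlgebraicGeometry.Motives
open AlgebraicGeometry.Scheme.IdealSheafData

namespace Summit.ResolutionOfSingularities.ResolutionOfSingularities.Cruxes.EquisingularLiftNat.Sections

/-- ★★ **`¬ IsoHypPoint` with finitely many non-regular points (closed images) ⟹ a non-regular point WITHOUT ANY `D`-LEVEL**, for every depth-graded
point-property `D` with UNFOLDING (`hDstep`) and LOCALITY (`hDloc`) — the contrapositive of ✓ `isoHypPoint_of_finiteDepthPoints`. [OURS]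
[cite: StacksProject, Tag 080E] -/
theorem exists_singularPoint_without_level (k : Type) [Field k] [IsAlgClosed k] (n : ℕ) (H : Scheme.{0})
    (ι : H ⟶ (projectiveSpace n k).left) [IsClosedImmersion ι] [IsIntegral H]
    (D : ℕ → ∀ Γ : Scheme.{0}, Γ → Prop)
    (hDstep : ∀ (d : ℕ) (Γ : Scheme.{0}) (y : Γ), D d Γ y → ∀ (hy : IsClosed (({y} : Set Γ))) (Z : Scheme.{0}) (τ : Z ⟶ Γ), IsBlowup τ (vanishingIdeal ⟨{y}, hy⟩) →
        ∃ S' : Finset Z, (∀ z : Z, τ z = y → z ∉ S' → IsRegularLocalRing (Z.presheaf.stalk z)) ∧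
          ∀ z ∈ S', τ z = y ∧ IsClosed (({z} : Set Z)) ∧ ∃ d' < d, D d' Z z)
    (hDloc : ∀ (d : ℕ) (Γ Γ₂ : Scheme.{0}) (ρ : Γ₂ ⟶ Γ) (U : Γ.Opens), IsIso (ρ ∣_ U) → ∀ y : Γ, y ∈ U → IsClosed (({y} : Set Γ)) →
      ∀ y₂ : Γ₂, ρ y₂ = y → IsClosed (({y₂} : Set Γ₂)) → (D d Γ y ↔ D d Γ₂ y₂))
    (hfin : Set.Finite {x : H | ¬ IsRegularLocalRing (H.presheaf.stalk x)})
    (hcl : ∀ x : H, ¬ IsRegularLocalRing (H.presheaf.stalk x) → IsClosed (({ι x} : Set (projectiveSpace n k).left)))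
    (hnot : ¬ IsoHypPoint k n H ι) :
    ∃ x : H, ¬ IsRegularLocalRing (H.presheaf.stalk x) ∧ ∀ d : ℕ, ¬ D d H x := by
  classical
  by_contra hcon
  push Not at hcon
  apply hnot
  refine isoHypPoint_of_finiteDepthPoints k n H ι D hDstep hDloc hfin.toFinset (fun x hx => hcl x (hfin.mem_toFinset.mp hx))
    (fun x hx => hfin.mem_toFinset.mp hx) (fun x hx => ?_) (fun x hx => hcon x (hfin.mem_toFinset.mp hx))
  by_contra h
  exact hx (hfin.mem_toFinset.mpr h)

/-- ★★★ **`¬ IsoHypPoint` with finitely many non-regular points (closed images) ⟹ a non-regular point OF INFINITE INTRINSIC BLOW-UP DEPTH**, for every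
blow-up tower `D` (`hD0`: level `0` = one-step; `hDsucc`: level `d + 1` = «every blow-up at the point is regular over it except at finitely many closed points
of levels `≤ d`») — the contrapositive of ✓ `isoHypPoint_of_towerPoints`: hypotheses #2 and #7 of the registered isolated residual stub force a singular
point that survives, over itself, every finite number of rounds of closed-point blow-ups. [OURS] [cite: StacksProject, Tag 080E] [cite: Hartshorne1977, V 3.9] -/
theorem exists_singularPoint_of_infinite_depth (k : Type) [Field k] [IsAlgClosed k] (n : ℕ) (H : Scheme.{0})
    (ι : H ⟶ (projectiveSpace n k).left) [IsClosedImmersion ι] [IsIntegral H]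
    (D : ℕ → ∀ Γ : Scheme.{0}, Γ → Prop)
    (hD0 : ∀ (Γ : Scheme.{0}) (y : Γ), IsClosed (({y} : Set Γ)) →
      (D 0 Γ y ↔ ∀ (hy : IsClosed (({y} : Set Γ))) (Z : Scheme.{0}) (τ : Z ⟶ Γ), IsBlowup τ (vanishingIdeal ⟨{y}, hy⟩) →
        ∀ z : Z, τ z = y → IsRegularLocalRing (Z.presheaf.stalk z)))
    (hDsucc : ∀ (d : ℕ) (Γ : Scheme.{0}) (y : Γ), IsClosed (({y} : Set Γ)) →
      (D (d + 1) Γ y ↔ ∀ (hy : IsClosed (({y} : Set Γ))) (Z : Scheme.{0}) (τ : Z ⟶ Γ), IsBlowup τ (vanishingIdeal ⟨{y}, hy⟩) →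
        ∃ S' : Finset Z, (∀ z : Z, τ z = y → z ∉ S' → IsRegularLocalRing (Z.presheaf.stalk z)) ∧
          ∀ z ∈ S', τ z = y ∧ IsClosed (({z} : Set Z)) ∧ ∃ d' ≤ d, D d' Z z))
    (hfin : Set.Finite {x : H | ¬ IsRegularLocalRing (H.presheaf.stalk x)})
    (hcl : ∀ x : H, ¬ IsRegularLocalRing (H.presheaf.stalk x) → IsClosed (({ι x} : Set (projectiveSpace n k).left)))
    (hnot : ¬ IsoHypPoint k n H ι) :
    ∃ x : H, ¬ IsRegularLocalRing (H.presheaf.stalk x) ∧ ∀ d : ℕ, ¬ D d H x :=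
  exists_singularPoint_without_level k n H ι D (tower_step D hD0 hDsucc) (tower_loc D hD0 hDsucc) hfin hcl hnot

/-- ★ **Blow-up towers are MONOTONE in the level** (at closed points): `D d Γ y → D (d + 1) Γ y` — a level-`0` point unfolds with the empty exceptional set,
a level-`(d+1)` point with levels `≤ d ≤ d + 1`.  So «`x` has a level» is «`x` has every large level», and `∃ d' ≤ d` in `hDsucc` costs nothing. [OURS] -/
theorem tower_mono (D : ℕ → ∀ Γ : Scheme.{0}, Γ → Prop)
    (hD0 : ∀ (Γ : Scheme.{0}) (y : Γ), IsClosed (({y} : Set Γ)) →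
      (D 0 Γ y ↔ ∀ (hy : IsClosed (({y} : Set Γ))) (Z : Scheme.{0}) (τ : Z ⟶ Γ), IsBlowup τ (vanishingIdeal ⟨{y}, hy⟩) →
        ∀ z : Z, τ z = y → IsRegularLocalRing (Z.presheaf.stalk z)))
    (hDsucc : ∀ (d : ℕ) (Γ : Scheme.{0}) (y : Γ), IsClosed (({y} : Set Γ)) →
      (D (d + 1) Γ y ↔ ∀ (hy : IsClosed (({y} : Set Γ))) (Z : Scheme.{0}) (τ : Z ⟶ Γ), IsBlowup τ (vanishingIdeal ⟨{y}, hy⟩) →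
        ∃ S' : Finset Z, (∀ z : Z, τ z = y → z ∉ S' → IsRegularLocalRing (Z.presheaf.stalk z)) ∧
          ∀ z ∈ S', τ z = y ∧ IsClosed (({z} : Set Z)) ∧ ∃ d' ≤ d, D d' Z z))
    (d : ℕ) (Γ : Scheme.{0}) (y : Γ) (hy : IsClosed (({y} : Set Γ))) (hD : D d Γ y) : D (d + 1) Γ y := by
  classical
  rw [hDsucc d Γ y hy]
  intro hy' Z τ hτ
  obtain ⟨S', hreg, hS'⟩ := tower_step D hD0 hDsucc d Γ y hD hy' Z τ hτ
  exact ⟨S', hreg, fun z hz => by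
    obtain ⟨hτz, hzcl, d', hd', hDz⟩ := hS' z hz
    exact ⟨hτz, hzcl, d', by omega, hDz⟩⟩

/-- ★ **Blow-up towers are UNIQUE up to `↔` at closed points**: two families satisfying `hD0` / `hDsucc` agree level by level (strong induction) — the
recursion pins the intrinsic tower down; a literal definition elsewhere changes nothing. [OURS] -/
theorem tower_unique (D : ℕ → ∀ Γ : Scheme.{0}, Γ → Prop)
    (hD0 : ∀ (Γ : Scheme.{0}) (y : Γ), IsClosed (({y} : Set Γ)) →
      (D 0 Γ y ↔ ∀ (hy : IsClosed (({y} : Set Γ))) (Z : Scheme.{0}) (τ : Z ⟶ Γ), IsBlowup τ (vanishingIdeal ⟨{y}, hy⟩) →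
        ∀ z : Z, τ z = y → IsRegularLocalRing (Z.presheaf.stalk z)))
    (hDsucc : ∀ (d : ℕ) (Γ : Scheme.{0}) (y : Γ), IsClosed (({y} : Set Γ)) →
      (D (d + 1) Γ y ↔ ∀ (hy : IsClosed (({y} : Set Γ))) (Z : Scheme.{0}) (τ : Z ⟶ Γ), IsBlowup τ (vanishingIdeal ⟨{y}, hy⟩) →
        ∃ S' : Finset Z, (∀ z : Z, τ z = y → z ∉ S' → IsRegularLocalRing (Z.presheaf.stalk z)) ∧
          ∀ z ∈ S', τ z = y ∧ IsClosed (({z} : Set Z)) ∧ ∃ d' ≤ d, D d' Z z))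
    (D' : ℕ → ∀ Γ : Scheme.{0}, Γ → Prop)
    (hD0' : ∀ (Γ : Scheme.{0}) (y : Γ), IsClosed (({y} : Set Γ)) →
      (D' 0 Γ y ↔ ∀ (hy : IsClosed (({y} : Set Γ))) (Z : Scheme.{0}) (τ : Z ⟶ Γ), IsBlowup τ (vanishingIdeal ⟨{y}, hy⟩) →
        ∀ z : Z, τ z = y → IsRegularLocalRing (Z.presheaf.stalk z)))
    (hDsucc' : ∀ (d : ℕ) (Γ : Scheme.{0}) (y : Γ), IsClosed (({y} : Set Γ)) →
      (D' (d + 1) Γ y ↔ ∀ (hy : IsClosed (({y} : Set Γ))) (Z : Scheme.{0}) (τ : Z ⟶ Γ), IsBlowup τ (vanishingIdeal ⟨{y}, hy⟩) →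
        ∃ S' : Finset Z, (∀ z : Z, τ z = y → z ∉ S' → IsRegularLocalRing (Z.presheaf.stalk z)) ∧
          ∀ z ∈ S', τ z = y ∧ IsClosed (({z} : Set Z)) ∧ ∃ d' ≤ d, D' d' Z z)) :
    ∀ (d : ℕ) (Γ : Scheme.{0}) (y : Γ), IsClosed (({y} : Set Γ)) → (D d Γ y ↔ D' d Γ y) := by
  intro d
  induction d using Nat.strong_induction_on with
  | _ d ih =>
  intro Γ y hy
  cases d with
  | zero => rw [hD0 Γ y hy, hD0' Γ y hy]
  | succ e =>
    rw [hDsucc e Γ y hy, hDsucc' e Γ y hy]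
    refine forall_congr' fun hy' => forall_congr' fun Z => forall_congr' fun τ => forall_congr' fun _ => exists_congr fun S' =>
      and_congr_right fun _ => forall_congr' fun z => forall_congr' fun _ => and_congr_right fun _ => and_congr_right fun hzcl =>
      exists_congr fun d' => and_congr_right fun hd' => ih d' (by omega) Z z hzcl

end Summit.ResolutionOfSingularities.ResolutionOfSingularities.Cruxes.EquisingularLiftNat.Sections

end
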